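import Literature.NumberTheory.PAdicHodge.DualExpElliptic
import HarnessLib

/-!
# The dual exponential of an elliptic curve in a TOWER `F ⊇ F₀ ⊇ K₀` of `p`-adic fields: the
# SIMULTANEOUS Néron normalisation of `exp*_ω` at `F₀` and at `F` (Kato II Thm. 1.4.1 + BK90 §3 at both fields)

Topic `Literature/NumberTheory/PAdicHodge`; sibling of `DualExpElliptic.lean` (p504202). One definition with body
(`expStarCoordTower` — the scalar `exp*_ω` on continuous crossed homomorphisms of the TOWER representation
`T_pW|_{Γ_{F₀}}|_{Γ_F}`, i.e. `T_pW` restricted along `Γ_F → Γ_{F₀} → Γ_{K₀}`; DEFINITIONALLY the BSD cell's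
`expStarOmega hL (r.comp (absGaloisRestrict K L)) d` on classes, `localTateRep_comp`) and ONE named fact (closed
`def … : Prop`, D-0014), cite-tagged clause by clause; no `sorry`, no instance.

## Why a tower version (cell `bsd-addord`, crux `stmt-BirchSwinnertonDyer-19560`, LEAD kim3 g15, STATUS
## 2026-08-27T07:21:10Z; consumers w2-acc4 DUALINT_{w₀}, the Kato-v2 supplier's (RES₀))

(S5b) of `DualExpElliptic` (`exists_smul_range_expStarCoord_iff_trace_log`) says: EVERY generator `d` of the line
`D⁰_dR` admits a rescaling `e • d` for which the range of `exp*_{e•ω}` on `H¹(F, T_pW)` is the trace-dual of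
`log_ω E(F)` — the rescaling `e ∈ Fˣ` (the class of the invariant differential `ω` of the model, up to a unit of
the STABILISER of the dual lattice in print; the statement records only `e ≠ 0`, a nonzero scalar — DD-145) being existential. In the per-factor clauses of the W2 packages TWO fields occur
at once — `F₀ = ℚ_v` and a finite extension `F = L_w` — with line data `d₀ / F₀`, `d / F` COMPARED by the
restriction functoriality of `exp*` (`exp*_d ∘ res_{F/F₀} = (F₀ → F) ∘ exp*_{d₀}`, the cell's kernel theorem (RES),
`Theorems/KimAtThreeDeepLowerExpStarOmegaRes`); applying (S5b) separately at `F₀` and at `F` yields two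
INDEPENDENT rescalings, and the stabiliser ambiguity at `F` is not controlled from `F₀` (kim3 / w2-acc4 FINDING-E:
on wild rows `log_ω E(L_w)` need not be `𝒪_{F₀}`-stable up to units only). The printed content has no such gap:
the Néron / invariant differential `ω` of the model `W` is ONE differential over `K₀`, its de Rham class at `F` is
the base change of its class at `F₀` (functoriality of `D_dR` and of `exp*` in the field, Kato II §1.2), and
Bloch–Kato / Kato's duality statements hold for THAT `ω` at every `p`-adic field. Hence:

* `exists_smul_range_expStarCoord_tower_iff_trace_log` — **for line data `d₀ / F₀` and `d / F` compatible under
  restriction, there is ONE `e ∈ F₀ˣ` such that `range(exp*_{e•d₀}|_{H¹(F₀,T)}) = (log_ω E(F₀))^∨_{Tr}` AND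
  `range(exp*_{e•d}|_{H¹(F,T)}) = (log_ω E(F))^∨_{Tr}`** (the simultaneous Néron normalisation; the scalar at `F`
  is `algebraMap F₀ F e`). At `F = F₀` this is (S5b). Sources as for (S5b), applied at both fields: Kato, LNM 1553,
  Ch. II Thm. 1.4.1 (3)–(4) with Lemma 1.4.3–1.4.5 (`exp* = ᵗexp`, trace form) and §1.2.4 (functoriality of `exp*`);
  Bloch–Kato 1990 Prop. 3.8 (perfect pairing on `H¹(K,T) × H¹(K, E[p^∞])`, `H¹_f` exact annihilators),
  Ex. 3.10.1 / (3.11.1) (`Kummer = exp ∘ log`), Ex. 3.11; Delbourgo 2008 §2.2 (trace formula); Silverman *AEC*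
  IV.6.4 / VII.2.2 (`log_ω`, the tree's `FormalGroupChart.padicLogPointFiniteExt`), III.§8 (Weil pairing).

READINGS (own attribution): as in `DualExpElliptic`; the identification of `T_pW|_{Γ_F}` along the tower with
`T_p(W ×_{K₀} F)`; `[ω]_F = [ω]_{F₀} ⊗ 1` under `D_dR(V|_{Γ_F}) = D_dR(V|_{Γ_{F₀}}) ⊗_{F₀} F`. NOT asserted: any
normalisation of `d₀` itself (scale-free), the value of the sign, anything at `ℓ ≠ p`.

## References

* K. Kato, LNM 1553 (1993), Ch. II §1.2.4, Prop. 1.2.3, Ex. 1.3.5, Thm. 1.4.1, Lemma 1.4.3–1.4.5. [Kato1993LNM1553]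
* S. Bloch, K. Kato (1990), Prop. 3.8, Def. 3.10, Ex. 3.10.1, Ex. 3.11. [BlochKato1990]
* D. Delbourgo (2008), §2.2, Ex. 2.5 and the trace formula. [Delbourgo2008]
* J. H. Silverman, *AEC* (2009), III.§8, IV.6.4, VII.2.2, VII.§4. [SilvermanAEC2009]
-/

noncomputable section

open scoped TensorProduct NNReal
open Field ValuativeRel
open Literature.NumberTheory.GaloisRepresentations
open Literature.NumberTheory.GaloisRepresentations.IsNonarchimedeanLocalField
open Literature.NumberTheory.EllipticCurves WeierstrassCurve

namespace Literature.NumberTheory.PAdicHodge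

/-! ### `exp*_ω` on the tower representation `T_pW|_{Γ_{F₀}}|_{Γ_F}` -/

section Tower

variable {K₀ : Type} [Field K₀] (W : WeierstrassCurve K₀) [W.IsElliptic]
  {F₀ : Type} [Field F₀] [Algebra K₀ F₀]
  {F : Type} [Field F] [Algebra F₀ F] [ValuativeRel F] [TopologicalSpace F]
  [IsNonarchimedeanLocalField F] [CharZero F] {p : ℕ} [Fact p.Prime]
  [Fact (¬ IsUnit (p : integerC F))] [IsAdicComplete (Ideal.span {(p : integerC F)}) (integerC F)]
  (hp : valuation F p < 1) [Algebra ℚ_[p] F]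

/-- **`exp*_ω(η) ∈ F` on the TOWER representation**: for a continuous crossed homomorphism `η : Γ_F → T_pW` of
`T_pW|_{Γ_{F₀}}|_{Γ_F}` (`T_pW` restricted along `absGaloisRestrict K₀ F₀ ∘ absGaloisRestrict F₀ F`; for `K₀ = ℚ`,
`F₀ = ℚ_v` this is the BSD cell's `localTateRep W p ((galRestrictPlace v).comp (absGaloisRestrict ℚ_v F))`,
`localTateRep_comp`) and a generator `d.ω` of `D⁰_dR` of the rational tower representation: Kato's `exp*`
(tree `PeriodRingData.dualExpCoord` for `bdRPeriodRingData hp`, `log χ_cyclo`) of `σ ↦ 1 ⊗ η(σ)` in the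
coordinate `d.ω` (= the cell's `expStarOmega hp (r.comp (absGaloisRestrict F₀ F)) d [η]`).
[cite: Kato1993LNM1553, Ch. II §1.2.4 and Ex. 1.3.5] -/
def expStarCoordTower
    (d : (bdRPeriodRingData (F := F) (p := p) hp).FilZeroLine
      ((restrictedRationalTateRep W F₀ p).restrict (absGaloisRestrict F₀ F)))
    (η : contOneCocycles ((restrictedTateRep W F₀ p).restrict (absGaloisRestrict F₀ F)).toTopRep) : F :=
  (bdRPeriodRingData hp).dualExpCoord (logCyclotomic p)
    ((restrictedRationalTateRep W F₀ p).restrict (absGaloisRestrict F₀ F)) d.ω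
    fun σ => TateModule.toRational p (η.1 σ)

end Tower

/-! ### The named fact -/

/-- **(S5b-tower) Tate duality at two levels of a tower, SIMULTANEOUS Néron normalisation.** For an elliptic
curve `W/K₀`, `p`-adic fields `F ⊇ F₀ ⊇ K₀` (each with an `ℝ≥0`-valued valuation compatible with its valuative
structure, for which the model is integral), generators `d₀` of `D⁰_dR(V_pW|_{Γ_{F₀}})` and `d` of `D⁰_dR` of the
tower representation `V_pW|_{Γ_{F₀}}|_{Γ_F}`, under the Prop-1.2.3 binders at both fields, and COMPATIBLE under
restriction — `exp*_d(η₀ ∘ res) = (F₀ → F)(exp*_{d₀}(η₀))` for every continuous crossed homomorphism `η₀` over `F₀`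
(the functoriality of `exp*` in the field; the cell's kernel theorem (RES) produces such `d` from `d₀`) — there is
ONE `e ∈ F₀ˣ` (the class of the invariant differential `ω` of the model up to a nonzero scalar; the statement records only `e ≠ 0`, DD-145) such that BOTH
`range(exp*_{e•d₀}|_{H¹(F₀, T_pW)}) = {a : ∀ P ∈ E(F₀), Tr_{F₀/ℚ_p}(a · log_ω P) ∈ ℤ_p}` AND
`range(exp*_{e•d}|_{H¹(F, T_pW)}) = {a : ∀ P ∈ E(F), Tr_{F/ℚ_p}(a · log_ω P) ∈ ℤ_p}` (the scalar at `F` being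
`algebraMap F₀ F e`). Chain: Kato II Thm. 1.4.1 (3)–(4) with Lemma 1.4.3–1.4.5 and §1.2.4, BK90 Prop. 3.8 / Ex. 3.10.1 /
(3.11.1) / Ex. 3.11, at `F₀` and at `F` for the SAME differential `ω` of `W` (`[ω]_F = [ω]_{F₀} ⊗ 1`); at `F = F₀`
this is `exists_smul_range_expStarCoord_iff_trace_log`. [cite: Kato1993LNM1553, Ch. II Thm. 1.4.1 (3)–(4), Lemma 1.4.3–1.4.5 and §1.2.4] [cite: BlochKato1990, Prop. 3.8 (p. 354), Ex. 3.10.1 (p. 359), Example 3.11 (3.11.1) (p. 361)] [cite: Delbourgo2008, §2.2 Ex. 2.5 and the trace formula for exp*] [cite: SilvermanAEC2009, III.§8, Thm. IV.6.4 with Prop. VII.2.2] -/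
def exists_smul_range_expStarCoord_tower_iff_trace_log : Prop :=
  ∀ {K₀ : Type} [Field K₀] [CharZero K₀] (W : WeierstrassCurve K₀) [W.IsElliptic]
    -- the lower field `F₀ ⊇ K₀`
    {F₀ : Type} [Field F₀] [Algebra K₀ F₀] [ValuativeRel F₀] [TopologicalSpace F₀]
    [IsNonarchimedeanLocalField F₀] [CharZero F₀] {p : ℕ} [Fact p.Prime]
    [Fact (¬ IsUnit (p : integerC F₀))] [IsAdicComplete (Ideal.span {(p : integerC F₀)}) (integerC F₀)]
    (hp₀ : valuation F₀ p < 1) [Algebra ℚ_[p] F₀]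
    (w₀ : Valuation F₀ ℝ≥0) [w₀.Compatible] [(W.baseChange F₀).IsIntegral w₀.integer]
    -- the upper field `F ⊇ F₀`
    {F : Type} [Field F] [Algebra K₀ F] [Algebra F₀ F] [IsScalarTower K₀ F₀ F] [ValuativeRel F]
    [TopologicalSpace F] [IsNonarchimedeanLocalField F] [CharZero F]
    [Fact (¬ IsUnit (p : integerC F))] [IsAdicComplete (Ideal.span {(p : integerC F)}) (integerC F)]
    (hp : valuation F p < 1) [Algebra ℚ_[p] F]
    (w : Valuation F ℝ≥0) [w.Compatible] [(W.baseChange F).IsIntegral w.integer]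
    -- line data at both levels
    (d₀ : (bdRPeriodRingData (F := F₀) (p := p) hp₀).FilZeroLine (restrictedRationalTateRep W F₀ p))
    (d : (bdRPeriodRingData (F := F) (p := p) hp).FilZeroLine
      ((restrictedRationalTateRep W F₀ p).restrict (absGaloisRestrict F₀ F))),
    -- Prop-1.2.3 binders at both levels
    (bdRPeriodRingData hp₀).CupLogInjective (logCyclotomic p) (restrictedRationalTateRep W F₀ p) →
    (∀ z : contOneCocycles (restrictedRationalTateRep W F₀ p).toTopRep,
      (bdRPeriodRingData hp₀).HasDualExp (logCyclotomic p) (restrictedRationalTateRep W F₀ p) fun σ => z.1 σ) →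
    (bdRPeriodRingData hp).CupLogInjective (logCyclotomic p)
      ((restrictedRationalTateRep W F₀ p).restrict (absGaloisRestrict F₀ F)) →
    (∀ z : contOneCocycles ((restrictedRationalTateRep W F₀ p).restrict (absGaloisRestrict F₀ F)).toTopRep,
      (bdRPeriodRingData hp).HasDualExp (logCyclotomic p)
        ((restrictedRationalTateRep W F₀ p).restrict (absGaloisRestrict F₀ F)) fun σ => z.1 σ) →
    -- compatibility of the line data under restriction (`exp*_d ∘ res = (F₀ → F) ∘ exp*_{d₀}`)
    (∀ (η₀ : contOneCocycles (restrictedTateRep W F₀ p).toTopRep)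
        (η : contOneCocycles ((restrictedTateRep W F₀ p).restrict (absGaloisRestrict F₀ F)).toTopRep),
        (∀ σ, η.1 σ = η₀.1 (absGaloisRestrict F₀ F σ)) →
        expStarCoordTower W hp d η = algebraMap F₀ F (expStarCoord W hp₀ d₀ η₀)) →
    ∃ (e : F₀) (he : e ≠ 0),
      (∀ a₀ : F₀,
        (∃ η₀ : contOneCocycles (restrictedTateRep W F₀ p).toTopRep,
            expStarCoord W hp₀ (d₀.smul e he) η₀ = a₀) ↔
          ∀ P : (W.baseChange F₀).toAffine.Point,
            ‖Algebra.trace ℚ_[p] F₀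
                (a₀ * FormalGroupChart.padicLogPointFiniteExt w₀ (W.baseChange F₀) p P)‖ ≤ 1) ∧
      (∀ a : F,
        (∃ η : contOneCocycles ((restrictedTateRep W F₀ p).restrict (absGaloisRestrict F₀ F)).toTopRep,
            expStarCoordTower W hp (d.smul (algebraMap F₀ F e) ((map_ne_zero (algebraMap F₀ F)).mpr he)) η = a) ↔
          ∀ P : (W.baseChange F).toAffine.Point,
            ‖Algebra.trace ℚ_[p] F
                (a * FormalGroupChart.padicLogPointFiniteExt w (W.baseChange F) p P)‖ ≤ 1)

end Literature.NumberTheory.PAdicHodge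

end
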